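import Summits.AnomalousDissipation.AnomalousDissipation.Theses.PumpSignGate
import Summits.AnomalousDissipation.AnomalousDissipation.Theorems.SteadyMirrorGateTameMirrorLimitTG
import Literature.Analysis.FluidPDE.EnergySpaceRellich
import Literature.Analysis.FluidPDE.SteadyNavierStokesProofs
import Literature.Analysis.FluidPDE.CylindricalGenerator
import Literature.Analysis.FluidPDE.StatisticalSolutionEnergyEq
import Literature.Analysis.FluidPDE.PassiveVectorWeakGradientHighModePairing
import Literature.Analysis.FunctionSpaces.DiagonalWeakLimits

/-!
# Route PumpSignGate — support `TameSignedMirrorLimitTG` (stmt-AnomalousDissipation-27674): tools I (§1–§2)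

Part 1 of 3 of the lens-6 g57 kernel K3 (see the TREE LANDING NOTE in `PumpSignGateTameSignedMirrorLimitTG.lean`): the closed a.e.
mirror class, the Rellich passage with the subsequence exposed (`exists_subseq_steadyWeakEuler_of_enstrophy_le`, any force, any closed
`S ⊆ H`) and `Lp` bookkeeping lemmas. Declarations byte-identical to K3 except three REUSED from the tree per the gate's
near-duplicate rule: `isClosed_mirrorClassK`, `nsGeneratorPairing_zero_eq_sub` (= `Theorems/SteadyMirrorGateTameMirrorLimitTG.lean`, lens-6 K2,
imported) and the one-liner `coord_smul` (inlined as `PiLp.smul_apply, smul_eq_mul` at its three use sites in part 2); namespace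
`…Theorems.PumpSignGateTame`. [folklore]
-/

-- `Summit.<Summit>.<Problem>` is the tree's mandated summit-side namespace (CONVENTIONS §2); single-conjunct summit, duplicate deliberate.
set_option linter.dupNamespace false

noncomputable section

namespace Summit.AnomalousDissipation.AnomalousDissipation.Theorems

namespace PumpSignGateTame

open MeasureTheory Filter Topology
open scoped InnerProductSpace ENNReal
open Literature.Analysis.FunctionSpaces Literature.Analysis.FluidPDE
open Literature.Analysis.FunctionSpaces.Torus Literature.Analysis.FluidPDE.Torus
open Summit.AnomalousDissipation.AnomalousDissipation.Theses.PumpSignGate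

/-! ## §1 Rellich passage with the subsequence exposed -/

/-- **Rellich passage, subsequence exposed (any force).**  Steady weak solutions `u_n ∈ H` of
`NS_{ν_n}(f)` with `ν_n → 0`, in a closed set `S ⊆ H` and a fixed enstrophy ball, have a subsequence
converging in `H` to some `v ∈ V ∩ S` which is a steady weak Euler state of `f`. [folklore] -/
theorem exists_subseq_steadyWeakEuler_of_enstrophy_le (f : UnitAddTorus (Fin 3) → EuclideanSpace ℝ (Fin 3))
    (S : Set (energySpace (Fin 3))) (hS : IsClosed S) (M : ℝ) (ν : ℕ → ℝ) (u : ℕ → energySpace (Fin 3))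
    (hνlim : Tendsto ν atTop (𝓝 0))
    (hsol : ∀ n, IsSteadyWeakSolution (ν n) f (u n))
    (hmem : ∀ n, u n ∈ S)
    (hens : ∀ n, eGradNormSq ((u n : Lp (EuclideanSpace ℝ (Fin 3)) 2 (volume : Measure (UnitAddTorus (Fin 3)))) : UnitAddTorus (Fin 3) → EuclideanSpace ℝ (Fin 3)) ≤
      ENNReal.ofReal M) :
    ∃ (v : energySpace (Fin 3)) (ψ : ℕ → ℕ), StrictMono ψ ∧ Tendsto (fun n => u (ψ n)) atTop (𝓝 v) ∧
      (v : Lp (EuclideanSpace ℝ (Fin 3)) 2 (volume : Measure (UnitAddTorus (Fin 3)))) ∈ energySpaceV (Fin 3) ∧ v ∈ S ∧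
      IsSteadyWeakSolution 0 f v := by
  set K : Set (energySpace (Fin 3)) :=
    {w | eGradNormSq ((w : Lp (EuclideanSpace ℝ (Fin 3)) 2 (volume : Measure (UnitAddTorus (Fin 3)))) : UnitAddTorus (Fin 3) → EuclideanSpace ℝ (Fin 3)) ≤
      ENNReal.ofReal M} with hK
  have hKc : IsCompact K := isCompact_setOf_eGradNormSq_le ENNReal.ofReal_ne_top
  have hUK : ∀ n, u n ∈ K := fun n => hens n
  obtain ⟨v₀, hv₀K, ψ, hψ, hlim⟩ := hKc.tendsto_subseq hUK
  refine ⟨v₀, ψ, hψ, hlim, ?_, ?_, ?_⟩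
  · exact ⟨v₀.2, memSobolev_one_complexify_of_eGradNormSq_ne_top (Lp.memLp _)
      (ne_top_of_le_ne_top ENNReal.ofReal_ne_top hv₀K)⟩
  · exact hS.mem_of_tendsto hlim (Eventually.of_forall fun n => hmem (ψ n))
  · intro w hw hwd hwm
    have hA : Tendsto (fun n => nsGeneratorPairing 0 f (u (ψ n)) w) atTop
        (𝓝 (nsGeneratorPairing 0 f v₀ w)) :=
      ((continuous_nsGeneratorPairing 0 f hw).tendsto v₀).comp hlim
    have hP : Tendsto (fun n => pairing ((u (ψ n) : Lp (EuclideanSpace ℝ (Fin 3)) 2 (volume : Measure (UnitAddTorus (Fin 3))))) (Torus.laplacian w)) atTop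
        (𝓝 (pairing (v₀ : Lp (EuclideanSpace ℝ (Fin 3)) 2 (volume : Measure (UnitAddTorus (Fin 3)))) (Torus.laplacian w))) :=
      ((continuous_pairing_coe (hw.laplacian.memLp 2)).tendsto v₀).comp hlim
    have hνψ : Tendsto (fun n => ν (ψ n)) atTop (𝓝 0) := hνlim.comp hψ.tendsto_atTop
    have hB : Tendsto (fun n => nsGeneratorPairing 0 f (u (ψ n)) w) atTop (𝓝 0) := by
      have h1 : Tendsto (fun n => ν (ψ n) * pairing ((u (ψ n) : Lp (EuclideanSpace ℝ (Fin 3)) 2 (volume : Measure (UnitAddTorus (Fin 3))))) (Torus.laplacian w))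
          atTop (𝓝 0) := by
        have h := hνψ.mul hP
        rw [zero_mul] at h
        exact h
      have h2 : (fun n => nsGeneratorPairing 0 f (u (ψ n)) w) =
          fun n => 0 - ν (ψ n) * pairing ((u (ψ n) : Lp (EuclideanSpace ℝ (Fin 3)) 2 (volume : Measure (UnitAddTorus (Fin 3))))) (Torus.laplacian w) := by
        funext n
        rw [nsGeneratorPairing_zero_eq_sub (ν (ψ n)) f (u (ψ n)) w, hsol (ψ n) w hw hwd hwm]
      rw [h2]
      have h3 := (tendsto_const_nhds (x := (0 : ℝ))).sub h1
      rw [sub_zero] at h3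
      exact h3
    exact tendsto_nhds_unique hA hB

/-! ## §2 `L²` bookkeeping: pairings as integrals, the witness bound -/

/-- `⟪w, [g]⟫ = ∫ ⟪w, g⟫` for an `L²` class `w` and an `L²` function `g`. [folklore] -/
theorem inner_toLp_eq_integral {α : Type*} [MeasurableSpace α] {μ : Measure α} {F : Type*}
    [NormedAddCommGroup F] [InnerProductSpace ℝ F] (w : Lp F 2 μ) {g : α → F} (hg : MemLp g 2 μ) :
    ⟪w, hg.toLp g⟫_ℝ = ∫ x, ⟪(w : α → F) x, g x⟫_ℝ ∂μ := by
  rw [MeasureTheory.L2.inner_def]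
  refine integral_congr_ae ?_
  filter_upwards [hg.coeFn_toLp] with x hx
  rw [hx]

/-- `⟪[f], [g]⟫ = ∫ ⟪f, g⟫` for `L²` functions `f, g`. [folklore] -/
theorem inner_toLp_toLp_eq_integral {α : Type*} [MeasurableSpace α] {μ : Measure α} {F : Type*}
    [NormedAddCommGroup F] [InnerProductSpace ℝ F] {f g : α → F} (hf : MemLp f 2 μ) (hg : MemLp g 2 μ) :
    ⟪hf.toLp f, hg.toLp g⟫_ℝ = ∫ x, ⟪f x, g x⟫_ℝ ∂μ := by
  rw [inner_toLp_eq_integral]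
  refine integral_congr_ae ?_
  filter_upwards [hf.coeFn_toLp] with x hx
  rw [hx]

/-- `‖[g]‖² ≤ M` when `∫ ‖g‖² ≤ M`. [folklore] -/
theorem sq_norm_toLp_le {α : Type*} [MeasurableSpace α] {μ : Measure α} {F : Type*}
    [NormedAddCommGroup F] [InnerProductSpace ℝ F] {g : α → F} (hg : MemLp g 2 μ) {M : ℝ} (hM : 0 ≤ M)
    (hle : ∫⁻ x, ‖g x‖ₑ ^ 2 ∂μ ≤ ENNReal.ofReal M) : ‖hg.toLp g‖ ^ 2 ≤ M := by
  rw [← real_inner_self_eq_norm_sq, MeasureTheory.L2.inner_def, MeasureTheory.L2.integral_inner_eq_sq_eLpNorm]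
  refine ENNReal.toReal_le_of_le_ofReal hM (le_trans (le_of_eq ?_) hle)
  refine lintegral_congr_ae ?_
  filter_upwards [hg.coeFn_toLp] with x hx
  rw [hx, ENNReal.rpow_two]
  rfl

/-- The `L²` mass of one honest weak partial derivative is at most the spectral enstrophy.
[cite: Grafakos2014, Prop. 3.2.7 (3)] -/
theorem lintegral_enorm_sq_le_eGradNormSq {u : UnitAddTorus (Fin 3) → EuclideanSpace ℝ (Fin 3)}
    (hu : MemLp u 2 volume) {g : Fin 3 → UnitAddTorus (Fin 3) → EuclideanSpace ℝ (Fin 3)}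
    (hg : ∀ j, MemLp (g j) 2 volume) (hwd : ∀ j, HasWeakPartialDeriv j u (g j)) (j : Fin 3) :
    ∫⁻ x, ‖g j x‖ₑ ^ 2 ≤ eGradNormSq u := by
  rw [eGradNormSq_eq_lintegral_of_hasWeakPartialDeriv hu hg hwd]
  exact lintegral_mono fun x =>
    Finset.single_le_sum (f := fun j => ‖g j x‖ₑ ^ 2) (fun _ _ => by positivity) (Finset.mem_univ j)

/-- `⟪w, c • e_i⟫ = c · w_i` in `ℝ³`. [folklore] -/
theorem inner_smul_single_one (w : EuclideanSpace ℝ (Fin 3)) (c : ℝ) (i : Fin 3) :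
    ⟪w, c • EuclideanSpace.single i (1 : ℝ)⟫_ℝ = c * w i := by
  rw [real_inner_smul_right, EuclideanSpace.inner_single_right]
  simp

/-- The continuous test fields `ψ e_i` are in `L²(T³; ℝ³)`. [folklore] -/
theorem memLp_two_smul_single {ψ : UnitAddTorus (Fin 3) → ℝ} (hψ : Continuous ψ) (i : Fin 3) :
    MemLp (fun x => ψ x • EuclideanSpace.single i (1 : ℝ)) 2 (volume : Measure (UnitAddTorus (Fin 3))) := by
  obtain ⟨C, hC⟩ := exists_forall_norm_le_of_continuous_torus (hψ.smul continuous_const :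
    Continuous fun x => ψ x • EuclideanSpace.single i (1 : ℝ))
  exact (memLp_top_of_bound (hψ.smul continuous_const).aestronglyMeasurable C
    (Eventually.of_forall hC)).mono_exponent le_top

/-- A bounded (a.e.) strongly measurable field on the torus is in `L²`. [folklore] -/
theorem memLp_two_of_bound {F : Type*} [NormedAddCommGroup F] [NormedSpace ℝ F]
    {z : UnitAddTorus (Fin 3) → F} (hz : AEStronglyMeasurable z volume) (C : ℝ) (hC : ∀ x, ‖z x‖ ≤ C) :
    MemLp z 2 volume :=
  (memLp_top_of_bound hz C (Eventually.of_forall hC)).mono_exponent le_top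

end PumpSignGateTame

end Summit.AnomalousDissipation.AnomalousDissipation.Theorems

end
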